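import Summits.FinalStateConjecture.FinalStateConjecture.Theses.LeakageWritesInInk
import Summits.FinalStateConjecture.FinalStateConjecture.Theorems.LeakageWritesInInkSpectralBootstrap

/-!
# Line `cascade-ink` for crux `LeakageTimeAnalyticity` (stmt-FinalStateConjecture-10225), route LeakageWritesInInk

Strategist skeleton (crux-strategist outputs (a)+(b), 2026-08-17). The crux is DERIVED from three registered stubs
which ARE the route items filed today as its layer 2 (route file rev 4), each stated BY NAME (head constant = the
registered obligation):

* `stub_temporalCascade       : TemporalCascade`       (item stmt-FinalStateConjecture-18181, crux rank 2 — the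
  physics: the windowed CASCADE INEQUALITY for the canonical temporal Littlewood–Paley TAIL profile of `G` along `∂₀`,
  given the decay package of stub 2);
* `stub_profileTailDecay      : ProfileTailDecay`      (item stmt-FinalStateConjecture-18240, support — classical LP
  decay: boundedness on `ℝ` and rapid decay on `λ ≥ 1` of every `prof k`);
* `stub_stripFromProfileDecay : StripFromProfileDecay` (item stmt-FinalStateConjecture-18241, support —
  Paley–Wiener synthesis: exponential decay of some `prof k` gives the uniform strip);

and the kernel-checked composition `LeakageTimeAnalyticity_of` runs the PROVED `SpectralBootstrap`
(`Theorems.LeakageWritesInInk.spectralBootstrap_proof`) between them on the profile rescaled into `[0,1]`.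
Proving an item closes its stub (same constant). The same composition is the glue item
`LeakageTimeAnalyticityOfSplit` (stmt-FinalStateConjecture-18326), candidate proof attached there (Glue.lean).
Birth skeletons one level down: `Cruxes/TemporalCascade/Lines/birth.lean` (uniform piece bound | pair-source physics |
abstract envelope lemma), `Cruxes/ProfileTailDecay/Lines/birth.lean` (two pointwise stubs, sSup bookkeeping proved).

Canonical profile (pinned inline in the items): `β(ξ) = Real.smoothTransition (2 − ξ²)`, `χ = β − β(2·)`
(`supp χ ⊂ {1/2 ≤ |ξ| ≤ √2}`, `Σ_j χ(ξ/2^j) = 1` off `0`), `φ(τ) = ∫ cos(2πξτ) χ(ξ) dξ`,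
`(P_ν G)(x) = ∫ ν φ(ντ) • G(x + τ ∂₀) dτ`, `prof k lam = sSup {‖iteratedFDeriv ℝ m (P_ν G) x‖ : ν ≥ lam, m ≤ k, x ∈ region}`.
-/

set_option linter.dupNamespace false

namespace Summit.FinalStateConjecture.FinalStateConjecture.Cruxes.LeakageTimeAnalyticity.CascadeInk

open Summit.FinalStateConjecture.FinalStateConjecture.Theses.LeakageWritesInInk

/-- stub 1 (hardest; = route item `TemporalCascade`, stmt-FinalStateConjecture-18181): the windowed cascade inequality
for the canonical temporal tail profile, given its boundedness + rapid decay. -/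
theorem stub_temporalCascade : TemporalCascade := by
  sorry

/-- stub 2 (= route item `ProfileTailDecay`, stmt-FinalStateConjecture-18240): boundedness on `ℝ` and rapid decay on
`λ ≥ 1` of every canonical tail profile `prof k` (classical Littlewood–Paley; provable now, size L). -/
theorem stub_profileTailDecay : ProfileTailDecay := by
  sorry

/-- stub 3 (= route item `StripFromProfileDecay`, stmt-FinalStateConjecture-18241): exponential decay of some `prof k`
gives the uniform strip (Paley–Wiener synthesis; provable now, size L). -/
theorem stub_stripFromProfileDecay : StripFromProfileDecay := by
  sorry

/-- **Composition** (real proof, no sorry): stubs 1–3 give the crux `LeakageTimeAnalyticity` BY NAME — instantiate at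
the canonical profile, feed stub 2 into stub 1, rescale `b := prof k / M ∈ [0,1]` (cascade constant `C ↦ C·M`), apply
the proved `SpectralBootstrap`, unscale, apply stub 3. -/
theorem LeakageTimeAnalyticity_of :
    TemporalCascade → ProfileTailDecay → StripFromProfileDecay →
      Summit.FinalStateConjecture.FinalStateConjecture.Theses.LeakageWritesInInk.LeakageTimeAnalyticity := by
  intro h1 h2 h3 a r₀ G hG
  set prof : ℕ → ℝ → ℝ := (fun (k : ℕ) (lam : ℝ) => sSup {q : ℝ | ∃ ν : ℝ, lam ≤ ν ∧ ∃ m : ℕ, m ≤ k ∧ ∃ x ∈ Literature.Geometry.Lorentzian.Kerr.region a r₀, q = ‖iteratedFDeriv ℝ m (fun y : Literature.Geometry.Lorentzian.E4 => ∫ τ : ℝ, (ν * (∫ ξ : ℝ, Real.cos (2 * Real.pi * ξ * (ν * τ)) * (Real.smoothTransition (2 - ξ ^ 2) - Real.smoothTransition (2 - (2 * ξ) ^ 2)))) • G (y + τ • Literature.Geometry.Lorentzian.E4.basisVector 0)) x‖}) with hprof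
  have c2 := h2 a r₀ G hG prof hprof
  have c1 := h1 a r₀ G hG prof hprof c2
  have c3 := h3 a r₀ G hG prof hprof
  obtain ⟨k, N, C, lam₁, hC, hcasc⟩ := c1
  obtain ⟨⟨M, hM, hbd⟩, hdec⟩ := c2 k
  -- the rescaled profile `b = prof k / M : ℝ → [0, 1]`
  set b : ℝ → ℝ := fun lam => prof k lam / M with hb_def
  have hb : ∀ lam : ℝ, 0 ≤ b lam ∧ b lam ≤ 1 := fun lam =>
    ⟨div_nonneg (hbd lam).1 hM.le, (div_le_one hM).2 (hbd lam).2⟩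
  have hbdec : ∀ K : ℕ, ∃ C' : ℝ, ∀ lam : ℝ, 1 ≤ lam → b lam ≤ C' / lam ^ K := by
    intro K
    obtain ⟨C', hC'⟩ := hdec K
    refine ⟨C' / M, fun lam hlam => ?_⟩
    calc b lam = prof k lam / M := rfl
      _ ≤ (C' / lam ^ K) / M := div_le_div_of_nonneg_right (hC' lam hlam) hM.le
      _ = C' / M / lam ^ K := by ring
  have hbcasc : ∀ lam : ℝ, lam₁ ≤ lam → ∃ μ ∈ Set.Icc (lam / 16) (lam / 2),
      b lam ≤ (C * M) * lam ^ N * (b μ * b (lam - μ)) := by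
    intro lam hlam
    obtain ⟨μ, hμ, hle⟩ := hcasc lam hlam
    refine ⟨μ, hμ, ?_⟩
    calc b lam = prof k lam / M := rfl
      _ ≤ C * lam ^ N * (prof k μ * prof k (lam - μ)) / M := div_le_div_of_nonneg_right hle hM.le
      _ = (C * M) * lam ^ N * ((prof k μ / M) * (prof k (lam - μ) / M)) := by
          field_simp
      _ = (C * M) * lam ^ N * (b μ * b (lam - μ)) := rfl
  obtain ⟨c, C', hc, hexpd⟩ :=
    Summit.FinalStateConjecture.FinalStateConjecture.Theorems.LeakageWritesInInk.spectralBootstrap_proof b N (C * M)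
      lam₁ (mul_pos hC hM) hb hbdec hbcasc
  refine c3 ⟨k, c, C' * M, hc, fun lam hlam => ?_⟩
  have hblam := hexpd lam hlam
  calc prof k lam = (prof k lam / M) * M := by field_simp
    _ = b lam * M := rfl
    _ ≤ C' * Real.exp (-(c * lam)) * M := by gcongr
    _ = C' * M * Real.exp (-(c * lam)) := by ring

/-- WIRING CHECK (an `example`, so no pre-composed witness enters the environment for an `exact?` probe): the three
sorried stubs compose to a closed term of the crux's type, modulo exactly their `sorry`s. -/
example : Summit.FinalStateConjecture.FinalStateConjecture.Theses.LeakageWritesInInk.LeakageTimeAnalyticity :=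
  LeakageTimeAnalyticity_of stub_temporalCascade stub_profileTailDecay stub_stripFromProfileDecay

end Summit.FinalStateConjecture.FinalStateConjecture.Cruxes.LeakageTimeAnalyticity.CascadeInk
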